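import Literature.Barriers.QuantumAdvantage.AaronsonChenMachine
import Literature.Barriers.QuantumAdvantage.AaronsonChenAdviceWeights
import Literature.Computability.Complexity.CodeFPArith
import Literature.Computability.Complexity.CodeFPBudgets
import Literature.Computability.Complexity.CodeFPLists
import HarnessLib

/-!
# Aaronson–Chen 2017, Lemma 5.3: the tables read off a history, as lists computed in polynomial time

Support file for `aaronsonChen2017_lem53` (`AaronsonChenOracle.lean`), on the line
`aaronsonChen2017_lem53_of_advice` (`AaronsonChenMachine.lean`) → `advLang ∈ PSPACE` →
`HeavyLang, CdfLang ∈ PSPACE` (`AaronsonChenAdvice.lean`) → exact threshold tests on path-pair counts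
of the annotated gate list `AcSim.annTab (tabsOf x₀ r h) (gates.take n)` (`AaronsonChenAdviceWeights.lean`:
`mem_HeavyLang_iff_linFormTest`, `sel_iff_linFormTest`). A polynomial-space evaluation of those
counts reads the replaced circuit from a CODE: the gate list (uniformity of the family) and, gate by
gate, the finite TABLE answering its `1`-side queries — Aaronson–Chen's `f_known` ("we use a
function `f_known` to encode our knowledge: if `x ∈ {0,1}^{2n}` has not been queried, `f_known(x)` is
set to be `*`; otherwise `f_known(x) := f(x)`", §5.3 p. 22), which the simulator's advice language
reads off the HISTORY `h` of its own answers (`AcProto.tabsOf`, `AaronsonChenProtocol.lean`: the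
decoded payloads of the complete, real, positively answered blocks). This file supplies that
table-extraction step:

* `AcProto.slotEnd`, `AcProto.slotHit` (block `(n, s)` is complete within `h`, carries the marker,
  and its `O`-answer was `1`), `AcProto.stageTab`, **`AcProto.tabList x₀ r h u`** — the table of
  stage `u` as a LIST — with **`mem_tabList_iff`**: it lists exactly `tabsOf x₀ r h u`
  (`tabsOf_eq_setOf_mem_tabList`, `tabsOf_eq`, `annTab_tabsOf`);
* **`AcProto.tabList_code`**, **`AcProto.tabLists_code`** — on the code `⟨⟨⟨x₀, r⟩, h⟩, u⟩`
  (`u` binary) the table, and the list of the tables of the first `n` stages, are computed in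
  polynomial time (`CodeFP`, `Complexity/CodeFP.lean`), in the raw list format `rawE (rawE strE)`
  read by the tree's list bricks; the pieces: `wl_code`, `Wd/Sm/Gm` codes (`un_eval_code`:
  polynomial schedule values by `Plumb.polyFn`), `evens_code`/`decodePad_code` (the transducers
  `evensT`/`decodePadT` of `AaronsonChenMachine.lean`), `blockOf_code`, `slotHit_code`
  (`true ∈ w ↔ 0 < ⟦w⟧`, bit reading as a one-symbol window), `stageTab_code`.

Design note: compositions of `CodeFP` combinators are elaborated WITHOUT expected type (`(… :)`)
and matched to the stated maps afterwards; elaborating them against a stated `fun` triggers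
higher-order unification with deep unfolding (minutes instead of seconds).

## References

* [AaronsonChen2017] S. Aaronson, L. Chen, *Complexity-theoretic foundations of quantum supremacy
  experiments*, CCC 2017 (doi:10.4230/LIPIcs.CCC.2017.22; arXiv:1612.05903), §5.3 (p. 22,
  "Construction and Analysis of g": `f_known`; p. 23, "all the computations can be done in PSPACE"),
  read via `lit read arxiv:1612.05903 --pages 21-23`.
* [AroraBarak2009] §1.2–1.3 (polynomial time, closure under composition and bounded loops), as
  packaged in `Complexity/CodeFP.lean`.
-/

noncomputable section

namespace Literature.Barriers.QuantumAdvantage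

open MeasureTheory _root_.Computability Polynomial Literature.Computability.Complexity
  Literature.Computability.Complexity.Brick Literature.Computability.Complexity.Plumb
  Literature.Computability.Cryptography Literature.Computability.QuantumComplexity CodeFP

/-! ### String lemmas -/

/-- A string contains a `1` iff its numeral value is positive. [folklore] -/
theorem true_mem_iff_bitsToNat_pos : ∀ l : List Bool, true ∈ l ↔ 0 < bitsToNat l
  | [] => by simp
  | b :: l => by
    rw [List.mem_cons, bitsToNat_cons, true_mem_iff_bitsToNat_pos l]
    cases b <;> simp

/-- Dropping at least the whole string (twin of `IntDetFP.drop_min_length`, `DeterminantFP.lean`, and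
of the `min`-capping idiom of `CodeFP.unOfNatMin`; re-proved to keep the imports inside the cone). [folklore] -/
theorem drop_min_length {α : Type*} (l : List α) (D : ℕ) : l.drop (min D l.length) = l.drop D := by
  rcases le_total D l.length with h | h
  · rw [min_eq_left h]
  · rw [min_eq_right h, List.drop_length, List.drop_eq_nil_of_le h]

/-- Reading a bit with default `0` as a one-symbol window. [folklore] -/
theorem getD_false_eq_decide (l : List Bool) (i : ℕ) : l.getD i false = decide ((l.drop i).take 1 = [true]) := by
  rw [List.getD_eq_getElem?_getD, ← List.head?_drop]
  cases l.drop i with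
  | nil => simp
  | cons b t => cases b <;> simp

/-! ### Polynomial schedule values on codes -/

/-- A polynomial of a unary numeral, in unary, by `Plumb.polyFn` (twin of
`QuantumComplexity.unPoly_codeFP`, `HidingProgramMachine.lean`, and of `Williams2014StageAFP.unPoly_code`;
re-proved in three lines to keep the imports inside the cone). [folklore] -/
theorem un_eval_code (p : Polynomial ℕ) : CodeFP unE unE (fun n => p.eval n) :=
  CodeFP.of_fn (polyFn p) (polyFn_mem_FP p) fun n => by rw [polyFn_apply, length_unE, unE_eq_ones]

/-- The even-position bits, on codes (the transducer `evensT`). [folklore] -/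
theorem evens_code : CodeFP strE strE evens :=
  CodeFP.of_fn evensT.eval evensT.polyTimeComputable_eval fun l => evensT_eval l

/-- Decoding a padded block `0^p 1 u ↦ u`, on codes (the transducer `decodePadT`). [folklore] -/
theorem decodePad_code : CodeFP strE strE decodePad :=
  CodeFP.of_fn decodePadT.eval decodePadT.polyTimeComputable_eval fun l => decodePadT_eval l

namespace AcProto

/-- The length `|⟨x₀, r⟩|` of the machine input, in unary, from the pair `(x₀, r)`. [folklore] -/
theorem wl_code : CodeFP (pairE strE strE) unE (fun p => wl p.1 p.2) := by
  obtain ⟨f, hf, h⟩ := strLength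
  exact ⟨f, hf, fun p => h (boolPair p.1 p.2)⟩

variable (P : AcProto)

/-- `Wd` in unary. [folklore] -/
theorem Wd_un_code : CodeFP unE unE P.Wd := (un_eval_code P.WdP).congr fun m => P.eval_WdP m

/-- `Wd` in binary. [folklore] -/
theorem Wd_nat_code : CodeFP unE natE P.Wd := (natOfUn.comp P.Wd_un_code).congr fun _ => rfl

/-- `Sm` in unary. [folklore] -/
theorem Sm_un_code : CodeFP unE unE P.Sm := (un_eval_code P.SmP).congr fun m => P.eval_SmP m

/-- `Sm` in binary. [folklore] -/
theorem Sm_nat_code : CodeFP unE natE P.Sm := (natOfUn.comp P.Sm_un_code).congr fun _ => rfl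

/-- `Gm` in unary. [folklore] -/
theorem Gm_un_code : CodeFP unE unE P.Gm := (un_eval_code P.pF).congr fun _ => rfl

/-! ### The tables read off a history, as lists -/

/-- The advice position right after block `s` of stage `n` (schedule of input length `m`). [folklore] -/
def slotEnd (m n s : ℕ) : ℕ := (n * P.Sm m + s + 1) * P.Wd m

/-- **The slot test**: block `(n, s)` is complete within the history `h` (its `O`-answer received),
real (marker present) and its `O`-answer was `1`. [folklore] -/
def slotHit (x₀ r h : List Bool) (n s : ℕ) : Bool :=
  decide (P.slotEnd (wl x₀ r) n s ≤ h.length / 2) &&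
    (decide (true ∈ P.blockOf x₀ r h n s) && h.getD (2 * P.slotEnd (wl x₀ r) n s - 1) false)

/-- The payloads of the hit slots of stage `n`, in slot order. [folklore] -/
def stageTab (x₀ r h : List Bool) (n : ℕ) : List (List Bool) :=
  ((List.range (P.Sm (wl x₀ r))).filter fun s => P.slotHit x₀ r h n s).map fun s =>
    decodePad (P.blockOf x₀ r h n s)

/-- **The table of stage `u` read off the history `h`, as a list**: the payloads of the hit slots
of the stages `n ≤ u` (`n < Gm`). [cite: AaronsonChen2017, §5.3 (p. 22, "we use a function f_known to encode our knowledge")] -/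
def tabList (x₀ r h : List Bool) (u : ℕ) : List (List Bool) :=
  ((List.range (min (u + 1) (P.Gm (wl x₀ r)))).map (P.stageTab x₀ r h)).flatten

/-- **The list form lists the table** `tabsOf` (`AaronsonChenProtocol.lean`). [folklore] -/
theorem mem_tabList_iff (x₀ r h : List Bool) (u : ℕ) (v : List Bool) :
    v ∈ P.tabList x₀ r h u ↔ v ∈ P.tabsOf x₀ r h u := by
  simp only [tabList, List.mem_flatten, List.mem_map, List.mem_range, tabsOf, Set.mem_setOf_eq]
  constructor
  · rintro ⟨l, ⟨n, hn, rfl⟩, hv⟩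
    simp only [stageTab, slotHit, slotEnd, List.mem_map, List.mem_filter, List.mem_range, Bool.and_eq_true,
      decide_eq_true_eq] at hv
    obtain ⟨s, ⟨hs, h1, h2, h3⟩, rfl⟩ := hv
    rw [lt_min_iff] at hn
    exact ⟨n, s, by omega, hn.2, hs, h1, h2, h3, rfl⟩
  · rintro ⟨n, s, hnu, hnG, hs, h1, h2, h3, rfl⟩
    refine ⟨_, ⟨n, lt_min_iff.2 ⟨by omega, hnG⟩, rfl⟩, ?_⟩
    simp only [stageTab, slotHit, slotEnd, List.mem_map, List.mem_filter, List.mem_range, Bool.and_eq_true,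
      decide_eq_true_eq]
    exact ⟨s, ⟨hs, h1, h2, h3⟩, rfl⟩

/-- The table as the set of members of the list. [folklore] -/
theorem tabsOf_eq_setOf_mem_tabList (x₀ r h : List Bool) (u : ℕ) :
    P.tabsOf x₀ r h u = {v | v ∈ P.tabList x₀ r h u} :=
  Set.ext fun v => (P.mem_tabList_iff x₀ r h u v).symm

/-- The tables as a function of the stage. [folklore] -/
theorem tabsOf_eq (x₀ r h : List Bool) : P.tabsOf x₀ r h = fun u => {v | v ∈ P.tabList x₀ r h u} :=
  funext fun u => P.tabsOf_eq_setOf_mem_tabList x₀ r h u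

/-- **The annotated prefix with the tables read off `h` is the one with the list tables.** [folklore] -/
theorem annTab_tabsOf (x₀ r h : List Bool) (gs : List (QGate cliffordT (P.nq x₀))) :
    AcSim.annTab (P.tabsOf x₀ r h) gs = AcSim.annTab (fun u => {v | v ∈ P.tabList x₀ r h u}) gs := by
  rw [P.tabsOf_eq x₀ r h]

/-! ### The list tables are computed on codes in polynomial time -/

/-- The code of a context `((x₀, r), h)`: `⟨⟨x₀, r⟩, h⟩`. [folklore] -/
abbrev ctxE : (List Bool × List Bool) × List Bool → List Bool := pairE (pairE strE strE) strE

/-- The code of a context with a stage and a slot, binary: `⟨⟨⟨⟨x₀, r⟩, h⟩, n⟩, s⟩`. [folklore] -/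
abbrev slotE : (((List Bool × List Bool) × List Bool) × ℕ) × ℕ → List Bool := pairE (pairE ctxE natE) natE

/-- The input length from a context, unary. [folklore] -/
theorem m_ctx_code : CodeFP ctxE unE (fun c => wl c.1.1 c.1.2) := wl_code.comp (CodeFP.fst _ _)

/-- The input length from a slot record, unary. [folklore] -/
theorem m_slot_code : CodeFP slotE unE (fun t => wl t.1.1.1.1 t.1.1.1.2) :=
  m_ctx_code.comp ((CodeFP.fst ctxE natE).comp (CodeFP.fst _ _))

/-- The history from a slot record. [folklore] -/
theorem h_slot_code : CodeFP slotE strE (fun t => t.1.1.2) :=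
  (CodeFP.snd _ strE).comp ((CodeFP.fst ctxE natE).comp (CodeFP.fst _ _))

/-- `slotEnd` on a slot record, binary. [folklore] -/
theorem slotEnd_code : CodeFP slotE natE (fun t => P.slotEnd (wl t.1.1.1.1 t.1.1.1.2) t.1.2 t.2) := by
  have hn : CodeFP slotE natE (fun t => t.1.2) := (CodeFP.fst (pairE ctxE natE) natE).snd'
  have hs : CodeFP slotE natE (fun t => t.2) := CodeFP.snd _ _
  have hSm : CodeFP slotE natE (fun t => P.Sm (wl t.1.1.1.1 t.1.1.1.2)) := (P.Sm_nat_code.comp m_slot_code :)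
  have hWd : CodeFP slotE natE (fun t => P.Wd (wl t.1.1.1.1 t.1.1.1.2)) := (P.Wd_nat_code.comp m_slot_code :)
  have h1 : CodeFP slotE natE (fun t => t.1.2 * P.Sm (wl t.1.1.1.1 t.1.1.1.2) + t.2 + 1) :=
    (natAdd.comp ((natAdd.comp ((natMul.comp (hn.pair hSm)).pair hs)).pair (CodeFP.const slotE 1)) :)
  exact (natMul.comp (h1.pair hWd) :)

/-- The drop amount `(n·S + s)·W` of block `(n, s)`, binary. [folklore] -/
theorem dropAmt_code :
    CodeFP slotE natE (fun t => (t.1.2 * P.Sm (wl t.1.1.1.1 t.1.1.1.2) + t.2) * P.Wd (wl t.1.1.1.1 t.1.1.1.2)) := by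
  have hn : CodeFP slotE natE (fun t => t.1.2) := (CodeFP.fst (pairE ctxE natE) natE).snd'
  have hs : CodeFP slotE natE (fun t => t.2) := CodeFP.snd _ _
  have hSm : CodeFP slotE natE (fun t => P.Sm (wl t.1.1.1.1 t.1.1.1.2)) := (P.Sm_nat_code.comp m_slot_code :)
  have hWd : CodeFP slotE natE (fun t => P.Wd (wl t.1.1.1.1 t.1.1.1.2)) := (P.Wd_nat_code.comp m_slot_code :)
  exact (natMul.comp ((natAdd.comp ((natMul.comp (hn.pair hSm)).pair hs)).pair hWd) :)

/-- **`blockOf` on a slot record.** [folklore] -/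
theorem blockOf_code : CodeFP slotE strE (fun t => P.blockOf t.1.1.1.1 t.1.1.1.2 t.1.1.2 t.1.2 t.2) := by
  have hevh : CodeFP slotE strE (fun t => evens t.1.1.2) := (evens_code.comp h_slot_code :)
  have hlen : CodeFP slotE unE (fun t => (evens t.1.1.2).length) := (strLength.comp hevh :)
  have hU : CodeFP slotE unE (fun t => min ((t.1.2 * P.Sm (wl t.1.1.1.1 t.1.1.1.2) + t.2) *
      P.Wd (wl t.1.1.1.1 t.1.1.1.2)) (evens t.1.1.2).length) := (unOfNatMin.comp (hlen.pair P.dropAmt_code) :)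
  have hdrop : CodeFP slotE strE (fun t => (evens t.1.1.2).drop ((t.1.2 * P.Sm (wl t.1.1.1.1 t.1.1.1.2) + t.2) *
      P.Wd (wl t.1.1.1.1 t.1.1.1.2))) :=
    (strDrop.comp (hU.pair hevh) :).congr fun t => drop_min_length _ _
  have hW : CodeFP slotE unE (fun t => P.Wd (wl t.1.1.1.1 t.1.1.1.2)) := (P.Wd_un_code.comp m_slot_code :)
  exact (strTake.comp (hW.pair hdrop) :).congr fun t => rfl

/-- **The slot test on a slot record.** [folklore] -/
theorem slotHit_code : CodeFP slotE bitE (fun t => P.slotHit t.1.1.1.1 t.1.1.1.2 t.1.1.2 t.1.2 t.2) := by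
  have hhalf : CodeFP slotE natE (fun t => t.1.1.2.length / 2) :=
    (natDiv.comp ((strNatLength.comp h_slot_code).pair (CodeFP.const slotE 2)) :)
  have c1 : CodeFP slotE bitE (fun t => decide (P.slotEnd (wl t.1.1.1.1 t.1.1.1.2) t.1.2 t.2 ≤ t.1.1.2.length / 2)) :=
    (natLe.comp (P.slotEnd_code.pair hhalf) :)
  have c2 : CodeFP slotE bitE (fun t => decide (true ∈ P.blockOf t.1.1.1.1 t.1.1.1.2 t.1.1.2 t.1.2 t.2)) :=
    (natLt.comp ((CodeFP.const slotE 0).pair (strVal.comp (P.blockOf_code))) :).congr fun t => by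
      simp only [true_mem_iff_bitsToNat_pos]
  have hi : CodeFP slotE natE (fun t => 2 * P.slotEnd (wl t.1.1.1.1 t.1.1.1.2) t.1.2 t.2 - 1) :=
    (natSub.comp ((natMul.comp ((CodeFP.const slotE 2).pair P.slotEnd_code)).pair (CodeFP.const slotE 1)) :)
  have hU : CodeFP slotE unE (fun t => min (2 * P.slotEnd (wl t.1.1.1.1 t.1.1.1.2) t.1.2 t.2 - 1) t.1.1.2.length) :=
    (unOfNatMin.comp ((strLength.comp h_slot_code).pair hi) :)
  have hdrop : CodeFP slotE strE (fun t => t.1.1.2.drop (2 * P.slotEnd (wl t.1.1.1.1 t.1.1.1.2) t.1.2 t.2 - 1)) :=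
    (strDrop.comp (hU.pair h_slot_code) :).congr fun t => drop_min_length _ _
  have hwin : CodeFP slotE strE (fun t => (t.1.1.2.drop (2 * P.slotEnd (wl t.1.1.1.1 t.1.1.1.2) t.1.2 t.2 - 1)).take 1) :=
    (strTake.comp ((CodeFP.const slotE 1).pair hdrop) :)
  have c3 : CodeFP slotE bitE (fun t => t.1.1.2.getD (2 * P.slotEnd (wl t.1.1.1.1 t.1.1.1.2) t.1.2 t.2 - 1) false) :=
    ((CodeFP.eq (eα := strE) (fun a b h => h)).comp (hwin.pair (CodeFP.const slotE [true])) :).congr fun t =>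
      (getD_false_eq_decide _ _).symm
  exact (c1.and (c2.and c3)).congr fun t => rfl

/-- **The table of one stage on a context with the stage number.** [folklore] -/
theorem stageTab_code : CodeFP (pairE ctxE natE) (rawE strE) (fun q => P.stageTab q.1.1.1 q.1.1.2 q.1.2 q.2) := by
  have hrange : CodeFP (pairE ctxE natE) (rawE natE) (fun q => List.range (P.Sm (wl q.1.1.1 q.1.1.2))) :=
    (urange.comp (P.Sm_un_code.comp (m_ctx_code.comp (CodeFP.fst ctxE natE))) :)
  have hfilter : CodeFP (pairE ctxE natE) (rawE natE) (fun q =>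
      (List.range (P.Sm (wl q.1.1.1 q.1.1.2))).filter fun s => P.slotHit q.1.1.1 q.1.1.2 q.1.2 q.2 s) :=
    ((CodeFP.filter (P.slotHit_code)).comp ((CodeFP.id _).pair hrange) :)
  have hpay : CodeFP slotE strE (fun t => decodePad (P.blockOf t.1.1.1.1 t.1.1.1.2 t.1.1.2 t.1.2 t.2)) :=
    (decodePad_code.comp P.blockOf_code :)
  have hmap := (CodeFP.map hpay).comp ((CodeFP.id _).pair hfilter)
  exact hmap.congr fun q => rfl

/-- **The table of stage `u` on a context with `u`** (binary). [cite: AaronsonChen2017, §5.3 (p. 22)] -/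
theorem tabList_code : CodeFP (pairE ctxE natE) (rawE strE) (fun q => P.tabList q.1.1.1 q.1.1.2 q.1.2 q.2) := by
  have hGm : CodeFP (pairE ctxE natE) unE (fun q => P.Gm (wl q.1.1.1 q.1.1.2)) :=
    (P.Gm_un_code.comp (m_ctx_code.comp (CodeFP.fst ctxE natE)) :)
  have hu1 : CodeFP (pairE ctxE natE) natE (fun q => q.2 + 1) :=
    (natAdd.comp ((CodeFP.snd ctxE natE).pair (CodeFP.const _ 1)) :)
  have hrange : CodeFP (pairE ctxE natE) (rawE natE) (fun q => List.range (min (q.2 + 1) (P.Gm (wl q.1.1.1 q.1.1.2)))) :=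
    (rangeOf.comp (hGm.pair hu1) :)
  have hmap := (CodeFP.map (P.stageTab_code)).comp ((CodeFP.fst ctxE natE).pair hrange)
  exact ((CodeFP.flatten strE).comp hmap).congr fun q => rfl

/-- **The tables of the first `n` stages** (as many as the schedule has, `min n Gm`) on a context with
`n` (binary) — the per-gate tables of the annotated prefix `annTab (tabsOf x₀ r h) (gates.take n)`.
[cite: AaronsonChen2017, §5.3 (pp. 22–23)] -/
theorem tabLists_code : CodeFP (pairE ctxE natE) (rawE (rawE strE)) (fun q =>
    (List.range (min q.2 (P.Gm (wl q.1.1.1 q.1.1.2)))).map (P.tabList q.1.1.1 q.1.1.2 q.1.2)) := by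
  have hGm : CodeFP (pairE ctxE natE) unE (fun q => P.Gm (wl q.1.1.1 q.1.1.2)) :=
    (P.Gm_un_code.comp (m_ctx_code.comp (CodeFP.fst ctxE natE)) :)
  have hrange : CodeFP (pairE ctxE natE) (rawE natE) (fun q => List.range (min q.2 (P.Gm (wl q.1.1.1 q.1.1.2)))) :=
    (rangeOf.comp (hGm.pair (CodeFP.snd ctxE natE)) :)
  have hmap := (CodeFP.map (P.tabList_code)).comp ((CodeFP.fst ctxE natE).pair hrange)
  exact hmap.congr fun q => rfl

end AcProto

end Literature.Barriers.QuantumAdvantage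

end
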